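import Literature.MathematicalPhysics.KineticTheory.IllnerPulvirentiGCHierarchy
import HarnessLib

/-!
# Illner–Pulvirenti (`illner_pulvirenti`, hilbert6.S03): the two remaining inputs on the
# grand-canonical BBGKY series as one named fact, and the theorem from it

Topic: MathematicalPhysics / KineticTheory. Librarian fact decomposition (`fact-decompose`, human
2026-08-16) of the budget-capped named fact
`Literature.MathematicalPhysics.KineticTheory.illner_pulvirenti` (**hilbert6.S03**; C. Cercignani,
R. Illner, M. Pulvirenti, *The Mathematical Theory of Dilute Gases* (1994), §4.5 Thm 4.5.1;
R. Illner, M. Pulvirenti, CMP 105 (1986), 121 (1989): global validity of the Boltzmann–Grad limit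
for a rare hard-sphere cloud expanding in the vacuum `ℝ^d`, `d ∈ {2, 3}`).

State of the tree: the Boltzmann side (Illner–Shinbrot global mild solutions with dispersive
Maxwellian bounds, CIP Thm 5.2.2; `illner_pulvirenti_boltzmann_side`), the term-by-term bounds on
both Duhamel series (CIP (5.9), (4.18); `abs_gcDuhamelTerm_le_global`), the measurability of the
honest grand-canonical BBGKY Duhamel terms and the dominated-convergence assembly are PROVED, and
`illner_pulvirenti_of_gcSeries` (`IllnerPulvirentiGCHierarchy.lean`, p37914) derives the named fact
from ONE displayed hypothesis on its own Duhamel series. This file names that hypothesis: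

* `illner_pulvirenti_gcSeriesInputs` — for `d ∈ {2,3}`, `β₀ > 0`, there is a threshold `c_B > 0`
  such that for every continuous datum `0 ≤ f₀ ≤ c_B e^{−(β₀/2)(|x|²+|v|²)}`, every horizon `T > 0`,
  every `ε_k → 0⁺` and all hard-sphere flows `Φ k N` on `ℝ^d` there are hard-sphere flows `Ψ k m`
  along which the grand-canonical BBGKY Duhamel series is built, with
  **(a)** *the series represents the correlation functions* — `∑_n Q^{ε_k}_{s,s+n}(t) F_k(0) =
  F_k^{(s)}(t)` a.e. on `[0, T]`, `F_k^{(s)}(t)` the rescaled correlation functions of the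
  grand-canonical state evolved by `Φ k` (the rigorous BBGKY hierarchy for hard spheres and its
  iteration: CIP 1994 Thm 4.3.1, (4.7), App. 4.A–4.B; Illner–Pulvirenti, Transport Theory Statist.
  Phys. 16 (1987)), and
  **(b)** *term-by-term convergence* — each `Q^{ε_k}_{s,s+n}(t) F_k(0)` converges to
  `Q⁰_{s,s+n}(t) f₀^{⊗(s+n)}` in the sense of observables, locally uniformly off the diagonal,
  uniformly on `[0,T]` (CIP §4.4, proof of Thm 4.4.1, Step 1, pp. 77–83; Lanford 1975; GST 2013
  Part III).
  (a) and (b) are recorded as ONE fact because they must hold along the SAME flows `Ψ` (the honest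
  Duhamel terms restrict functions to codimension-one collision surfaces, so they are not
  insensitive to the null sets on which two hard-sphere flows may differ; the freedom in `Ψ` absorbs
  this — see the docstring of `illner_pulvirenti_of_gcSeries`);
* `illner_pulvirenti_holds_of : illner_pulvirenti_gcSeriesInputs → illner_pulvirenti` — the
  assembly, `illner_pulvirenti_of_gcSeries`.

The child does not restate the parent: it speaks of the Duhamel series of the BBGKY hierarchy
(validity of the hierarchy and convergence of its terms), the parent of the existence of the
Boltzmann solution and the convergence of the correlation functions themselves.

## References

* C. Cercignani, R. Illner, M. Pulvirenti, *The Mathematical Theory of Dilute Gases*, Applied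
  Mathematical Sciences 106, Springer (1994): §4.3 Thm 4.3.1, §4.4 (4.7) and proof of Thm 4.4.1
  Step 1 (pp. 77–83), §4.5 Thm 4.5.1 and its proof (pp. 87–90), App. 4.A–4.B [CIP1994].
* R. Illner, M. Pulvirenti, Comm. Math. Phys. 105 (1986) 189–203; 121 (1989) 143–146; Transport
  Theory Statist. Phys. 16 (1987) 997–1012.
* I. Gallagher, L. Saint-Raymond, B. Texier, *From Newton to Boltzmann*, EMS (2013), Part III
  [GST2013].
-/

open MeasureTheory Metric Real Set Filter Topology Function
open scoped InnerProductSpace ENNReal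

namespace Literature.MathematicalPhysics.KineticTheory

noncomputable section

open Literature.Analysis.FluidPDE

variable {d : Type*} [Fintype d]

/-- **The two remaining inputs of Illner–Pulvirenti's theorem on the grand-canonical BBGKY
series of the rare cloud on `ℝ^d`** (CIP 1994, §4.5, proof of Thm 4.5.1, with §4.3 Thm 4.3.1 /
App. 4.A–4.B for (a) and §4.4 Step 1 for (b); Illner–Pulvirenti 1986/1987/1989): for `d ∈ {2,3}`
and `β₀ > 0` there is `c_B > 0` such that for every continuous `0 ≤ f₀ ≤ c_B e^{−(β₀/2)(|x|²+|v|²)}`,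
every `T > 0`, every sequence of diameters `ε_k → 0⁺` and all hard-sphere flows `Φ k N` on `ℝ^d`
(`HardSphereFlow (Euclidean.geometry d)`), there are hard-sphere flows `Ψ k m` such that, for the
honest Duhamel terms `Q^{ε_k}_{s,s+n}(t) F_k(0)` of the grand-canonical BBGKY hierarchy built along
`Ψ k` (lifted good-set transports `boundaryLift ∘ 1_{good} ∘ hsTransport`, operators
`∑_i C^i_{m,m+1,ε_k}` = `hsCollisionTerm`, data the initial rescaled correlation functions
`correlationFn (bgActivity d ε_k) (gcInitial … f₀)` in the Boltzmann–Grad scaling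
`μ_k ε_k^{d−1} = 1`):
**(a)** for every `k`, `s`, `t ∈ [0,T]`, `∑_n Q^{ε_k}_{s,s+n}(t) F_k(0)` equals almost everywhere the
rescaled `s`-particle correlation function at time `t` of the grand-canonical state evolved by the
given flows `Φ k` (`gcEvolved`) — validity and iteration of the BBGKY hierarchy for hard spheres;
**(b)** for all `s`, `n`, every continuous compactly supported velocity test function `ψ`, every
compact `K` off the diagonal and `δ > 0`, eventually in `k`, uniformly in `t ∈ [0,T]` and `xs ∈ K`,
the velocity average of `Q^{ε_k}_{s,s+n}(t) F_k(0)` is within `δ` of that of the Boltzmann Duhamel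
term `Q⁰_{s,s+n}(t) f₀^{⊗}` (`boltzmannDuhamelTerm`) — term-by-term convergence. This is the
hypothesis `h` of the tree's PROVED `illner_pulvirenti_of_gcSeries`, verbatim; (a) and (b) share
the flows `Ψ` and are therefore one statement.
[cite: CIP1994, §4.5 Thm 4.5.1, proof (pp. 88–90); §4.3 Thm 4.3.1 and App. 4.A–4.B; §4.4 proof of Thm 4.4.1, Step 1 (pp. 77–83)] -/
def illner_pulvirenti_gcSeriesInputs : Prop :=
  ∀ (_hd : Fintype.card d = 2 ∨ Fintype.card d = 3) {β₀ : ℝ}, 0 < β₀ →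
    ∃ c_B > (0 : ℝ), ∀ f₀ : EuclideanSpace ℝ d → EuclideanSpace ℝ d → ℝ,
      Continuous (uncurry f₀) →
      (∀ x v, 0 ≤ f₀ x v ∧ f₀ x v ≤ c_B * exp (-(β₀ / 2) * (‖x‖ ^ 2 + ‖v‖ ^ 2))) →
      ∀ T > (0 : ℝ), ∀ ε : ℕ → ℝ, (∀ k, 0 < ε k) → Tendsto ε atTop (𝓝 0) →
        ∀ Φ : (k N : ℕ) → HardSphereFlow (Euclidean.geometry d) (ε k) N,
          ∃ Ψ : (k m : ℕ) → HardSphereFlow (Euclidean.geometry d) (ε k) m,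
          (∀ k s, ∀ t ∈ Icc 0 T,
            (fun Z => ∑' n, duhamelTerm (fun m t' g => boundaryLift (Euclidean.geometry d) (ε k) m
                  ((Ψ k m).good.indicator (hsTransport (Ψ k m) t' g)))
                (fun m g W => ∑ i : Fin m, hsCollisionTerm (Euclidean.geometry d) (ε k) m i g W) n s t
                (fun m => correlationFn (bgActivity d (ε k))
                  (gcInitial (Euclidean.geometry d) (ε k) (bgActivity d (ε k)) (uncurry f₀)) m) Z)
              =ᵐ[volume]
              correlationFn (bgActivity d (ε k))
                (gcEvolved (Φ k) (gcInitial (Euclidean.geometry d) (ε k) (bgActivity d (ε k))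
                  (uncurry f₀)) t) s) ∧
          (∀ (s n : ℕ) (ψ : (Fin s → EuclideanSpace ℝ d) → ℝ), Continuous ψ → HasCompactSupport ψ →
            ∀ K ⊆ offDiag (X := EuclideanSpace ℝ d) s, IsCompact K → ∀ δ > (0 : ℝ),
              ∀ᶠ k in atTop, ∀ t ∈ Icc 0 T, ∀ xs ∈ K,
                |velocityAverage ψ
                    (duhamelTerm (fun m t' g => boundaryLift (Euclidean.geometry d) (ε k) m
                        ((Ψ k m).good.indicator (hsTransport (Ψ k m) t' g)))
                      (fun m g W => ∑ i : Fin m, hsCollisionTerm (Euclidean.geometry d) (ε k) m i g W)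
                      n s t
                      (fun m => correlationFn (bgActivity d (ε k))
                        (gcInitial (Euclidean.geometry d) (ε k) (bgActivity d (ε k)) (uncurry f₀)) m)) xs -
                  velocityAverage ψ (boltzmannDuhamelTerm (Euclidean.geometry d) n s t
                    (fun j => tensorPow j (uncurry f₀))) xs| ≤ δ)

/-- **Illner–Pulvirenti's theorem (`illner_pulvirenti`, hilbert6.S03) from the two inputs on its
grand-canonical BBGKY series** — the fact split: the tree's `illner_pulvirenti_of_gcSeries` (the
Boltzmann side, the uniform series bounds with threshold `4 c C_g ≤ 1`, measurability and the
dominated-convergence assembly are proved there and in its imports).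
[cite: CIP1994, §4.5 Thm 4.5.1, proof (pp. 88–90)] -/
theorem illner_pulvirenti_holds_of (h : illner_pulvirenti_gcSeriesInputs (d := d)) :
    illner_pulvirenti (d := d) :=
  illner_pulvirenti_of_gcSeries h

end

end Literature.MathematicalPhysics.KineticTheory
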